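import Summits.ABC.ABC.Theorems.PrimePowerRadical.Negative.NonWieferich

/-!
# `PrimePowerRadical` (stmt-ABC-1648): multiplicative orders — the ORDER BUDGET of a counterexample and the LEVEL LADDER of a proof

Negative-side analysis (cdisprove seat, cycle 2). With `ordMod q p = orderOf (q : ZMod p)`:
* `dvd_pow_sub_one_iff_ordMod_dvd` — `p ∣ q^k − 1 ↔ ord_p(q) ∣ k`; `ordMod_pos`, `ordMod_dvd_sub_one`;
* `pow_wieferichLevel_dvd` — De Leon's lemma in exact form: `p^{W_p(q)} ∣ q^{ord_p(q)} − 1`, whence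
  `pow_wieferichLevel_lt`: `W_p(q)·log p < ord_p(q)·log q` (a Wieferich prime weighs less than its order);
* `wieferichOrders q k ⊆ k.divisors` — the orders of the level-`≥ 2` odd primes dividing `q^k − 1`;
* `oddWieferichExcess_le_pow_sum_orders` — THE ORDER BUDGET `E_W(q,k) ≤ q^{Σ_{d ∈ wieferichOrders q k} d}`;
* `not_PPRAt_imp_order_budget` — so a counterexample to the crux at `q` needs `ε > 0` such that for every `M`
  some `k` carries Wieferich orders among its divisors of total `≥ M + εk`: Wieferich primes to base `q` sitting
  at multiplicative orders that fill a positive proportion of `k`, infinitely often (base 2: the known orders are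
  `364 = ord₁₀₉₃ 2` and `1755 = ord₃₅₁₁ 2`, and nothing else below `1.25·10^{15}`);
* `infinite_level_le_of_PPRAt` — THE LEVEL LADDER: conversely the crux at `q` and a SINGLE `ε` forces, for every
  integer `E > ε`, infinitely many primes of Wieferich level `≤ E` (if all odd `p > P₀` had level `≥ E+1` then
  `rad(q^k − 1) ≤ 2P·R'` with `R'^{E+1} ≤ q^k` — `prod_pow_dvd_of_levels_ge`, `radical_dvd_prod_large` — and
  `q^k < C (q·rad)^{1+ε} ≤ K q^{k(1+ε)/(E+1)}` is absurd); rung `E = 1` is Silverman's direction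
  (`Negative/NonWieferich.lean`), and no rung is known for any base (bounded-level non-Wieferich infinitude,
  BarrierNotes-r1-k2 B1 in the crux directory); `primePowerRadical_imp_infinite_level_le` gives the whole ladder.
-/

noncomputable section

namespace Summit.ABC.ABC.Theorems.PrimePowerRadical.Negative

open Literature.NumberTheory.DiophantineGeometry UniqueFactorizationMonoid
open Summit.ABC.ABC.Theses.IneffectiveSubspace

/-! ## The order budget of a counterexample -/

/-- The multiplicative order of `q` modulo `p` (as an element of `ZMod p`; `0` if `p ∣ q`, `1` if `p = 1`). [folklore] -/
def ordMod (q p : ℕ) : ℕ := orderOf (q : ZMod p)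

/-- `p ∣ q^k − 1 ↔ ord_p(q) ∣ k` (for a prime `p` and `q ≥ 1`). [folklore] -/
theorem dvd_pow_sub_one_iff_ordMod_dvd {q p : ℕ} (hp : p.Prime) (hq : 1 ≤ q) (k : ℕ) :
    p ∣ q ^ k - 1 ↔ ordMod q p ∣ k := by
  haveI := Fact.mk hp
  have hcast : ((q ^ k - 1 : ℕ) : ZMod p) = (q : ZMod p) ^ k - 1 := by
    rw [Nat.cast_sub (Nat.one_le_pow _ _ (by omega)), Nat.cast_pow, Nat.cast_one]
  rw [← ZMod.natCast_eq_zero_iff, hcast, sub_eq_zero, ordMod, orderOf_dvd_iff_pow_eq_one]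

/-- For a prime `p ∤ q`: `ord_p(q) ≥ 1`. [folklore] -/
theorem ordMod_pos {q p : ℕ} (hp : p.Prime) (hpq : ¬ p ∣ q) : 0 < ordMod q p := by
  haveI := Fact.mk hp
  have ha0 : (q : ZMod p) ≠ 0 := by rwa [Ne, ZMod.natCast_eq_zero_iff]
  exact Nat.pos_of_dvd_of_pos (ZMod.orderOf_dvd_card_sub_one ha0) (by have := hp.two_le; omega)

/-- For a prime `p ∤ q`: `ord_p(q) ∣ p − 1`. [folklore] -/
theorem ordMod_dvd_sub_one {q p : ℕ} (hp : p.Prime) (hpq : ¬ p ∣ q) : ordMod q p ∣ p - 1 := by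
  haveI := Fact.mk hp
  have ha0 : (q : ZMod p) ≠ 0 := by rwa [Ne, ZMod.natCast_eq_zero_iff]
  exact ZMod.orderOf_dvd_card_sub_one ha0

/-- **De Leon's lemma, exact form**: for an odd prime `p ∤ q` (`q ≥ 2`) with `d = ord_p(q)`,
`p^{W_p(q)} ∣ q^d − 1` — the full Wieferich level is already present in the SMALLEST member of the family
that `p` divides. [Ribenboim 1989, Ch. 5 §III (De Leon 1978)] [folklore] -/
theorem pow_wieferichLevel_dvd {q p : ℕ} (hq : 2 ≤ q) (hp : p.Prime) (hp2 : p ≠ 2) (hpq : ¬ p ∣ q) :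
    p ^ wieferichLevel q p ∣ q ^ ordMod q p - 1 := by
  haveI := Fact.mk hp
  have hd := ordMod_pos hp hpq
  have hpd : p ∣ q ^ ordMod q p - 1 := (dvd_pow_sub_one_iff_ordMod_dvd hp (by omega) _).mpr dvd_rfl
  have hn : q ^ ordMod q p - 1 ≠ 0 := by have := two_le_pow hq hd; omega
  refine (padicValNat_dvd_iff_le hn).mpr ?_
  rw [padicValNat_family hq hp hp2 hd hpd]
  omega

/-- **A Wieferich prime weighs less than its order**: `p^{W_p(q)} < q^{ord_p(q)}`, i.e.
`W_p(q)·log p < ord_p(q)·log q`. [folklore] -/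
theorem pow_wieferichLevel_lt {q p : ℕ} (hq : 2 ≤ q) (hp : p.Prime) (hp2 : p ≠ 2) (hpq : ¬ p ∣ q) :
    p ^ wieferichLevel q p < q ^ ordMod q p := by
  have hd := ordMod_pos hp hpq
  have h2 := two_le_pow hq hd
  have := Nat.le_of_dvd (by omega) (pow_wieferichLevel_dvd hq hp hp2 hpq)
  omega

/-- A product of powers of distinct primes divides `n` as soon as each prime power does. [folklore] -/
theorem prod_prime_pow_dvd_of_forall_dvd {S : Finset ℕ} (hS : ∀ r ∈ S, r.Prime) (e : ℕ → ℕ) {n : ℕ}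
    (hn : n ≠ 0) (h : ∀ r ∈ S, r ^ e r ∣ n) : ∏ r ∈ S, r ^ e r ∣ n := by
  have hP : ∏ r ∈ S, r ^ e r ≠ 0 :=
    Finset.prod_ne_zero_iff.mpr fun r hr => pow_ne_zero _ (hS r hr).ne_zero
  rw [← Nat.factorization_le_iff_dvd hP hn, Finsupp.le_def]
  intro p
  rw [factorization_prod_prime_pow hS e p]
  by_cases hp : p ∈ S
  · rw [if_pos hp]
    exact ((hS p hp).pow_dvd_iff_le_factorization hn).mp (h p hp)
  · rw [if_neg hp]; exact Nat.zero_le _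

/-- **The Wieferich excess only grows along the divisor lattice**: `k ∣ k' ⟹ E_W(q,k) ∣ E_W(q,k')`
(the primes persist and their exponents `W_p(q) − 1` do not depend on `k`). [folklore] -/
theorem oddWieferichExcess_dvd_of_dvd {q k k' : ℕ} (hq : 2 ≤ q) (hk' : 1 ≤ k') (h : k ∣ k') :
    oddWieferichExcess q k ∣ oddWieferichExcess q k' := by
  have hE := (oddWieferichExcess_pos q k).ne'
  have hE' := (oddWieferichExcess_pos q k').ne'
  have hn' : q ^ k' - 1 ≠ 0 := by have := two_le_pow hq hk'; omega
  have hsub : (q ^ k - 1).primeFactors.erase 2 ⊆ (q ^ k' - 1).primeFactors.erase 2 := by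
    intro p hp
    obtain ⟨hp2, hpF⟩ := Finset.mem_erase.mp hp
    have hpr := Nat.prime_of_mem_primeFactors hpF
    have hdvd : q ^ k - 1 ∣ q ^ k' - 1 := by
      obtain ⟨m, rfl⟩ := h
      have := Nat.sub_dvd_pow_sub_pow (q ^ k) 1 m
      rwa [one_pow, ← pow_mul] at this
    exact Finset.mem_erase.mpr ⟨hp2, Nat.mem_primeFactors.mpr
      ⟨hpr, dvd_trans (Nat.dvd_of_mem_primeFactors hpF) hdvd, hn'⟩⟩
  rw [← Nat.factorization_le_iff_dvd hE hE', Finsupp.le_def]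
  intro p
  rw [factorization_oddWieferichExcess, factorization_oddWieferichExcess]
  by_cases hp : p ∈ (q ^ k - 1).primeFactors.erase 2
  · rw [if_pos hp, if_pos (hsub hp)]
  · rw [if_neg hp]; exact Nat.zero_le _

/-- The Wieferich ORDER SET of `q^k − 1`: the multiplicative orders `ord_p(q)` of the odd primes `p ∣ q^k − 1`
of Wieferich level `≥ 2` (each such order divides `k`). [folklore] -/
def wieferichOrders (q k : ℕ) : Finset ℕ :=
  (((q ^ k - 1).primeFactors.erase 2).filter (fun p => 2 ≤ wieferichLevel q p)).image (ordMod q)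

/-- Every Wieferich order of `q^k − 1` divides `k` (for `k ≥ 1`, `q ≥ 2`). [folklore] -/
theorem wieferichOrders_subset_divisors {q k : ℕ} (hq : 2 ≤ q) (hk : 1 ≤ k) :
    wieferichOrders q k ⊆ k.divisors := by
  intro d hd
  obtain ⟨p, hp, rfl⟩ := Finset.mem_image.mp hd
  have hpS := (Finset.mem_filter.mp hp).1
  have hpP := Finset.mem_of_mem_erase hpS
  have hpr : p.Prime := Nat.prime_of_mem_primeFactors hpP
  have hpk : p ∣ q ^ k - 1 := Nat.dvd_of_mem_primeFactors hpP
  exact Nat.mem_divisors.mpr ⟨(dvd_pow_sub_one_iff_ordMod_dvd hpr (by omega) k).mp hpk, by omega⟩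

/-- **THE ORDER BUDGET.** `E_W(q,k) ≤ q^{Σ_{d ∈ wieferichOrders q k} d}`: grouping the Wieferich primes
inside `q^k − 1` by their order `d`, each group satisfies `∏ p^{W_p} ∣ q^d − 1` (De Leon, exact form), so
contributes less than `q^d`. Hence a counterexample to the crux at `q` needs, infinitely often, Wieferich
ORDERS among the divisors of `k` summing to `≥ εk` (`not_PPRAt_imp_order_budget`). [folklore] -/
theorem oddWieferichExcess_le_pow_sum_orders {q k : ℕ} (hq : q.Prime) (hk : 1 ≤ k) :
    oddWieferichExcess q k ≤ q ^ (∑ d ∈ wieferichOrders q k, d) := by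
  have hq2 := hq.two_le
  set S := (q ^ k - 1).primeFactors.erase 2 with hS
  set SW := S.filter (fun p => 2 ≤ wieferichLevel q p) with hSW
  have hmemS : ∀ p ∈ S, p.Prime ∧ p ≠ 2 ∧ p ∣ q ^ k - 1 ∧ ¬ p ∣ q := by
    intro p hp
    have hpP := Finset.mem_of_mem_erase hp
    have hpr : p.Prime := Nat.prime_of_mem_primeFactors hpP
    have hpk : p ∣ q ^ k - 1 := Nat.dvd_of_mem_primeFactors hpP
    exact ⟨hpr, (Finset.mem_erase.mp hp).1, hpk, not_dvd_base_of_dvd hpr hk (by omega) hpk⟩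
  -- step 1: only level ≥ 2 primes contribute
  have h1 : oddWieferichExcess q k = ∏ p ∈ SW, p ^ (wieferichLevel q p - 1) := by
    unfold oddWieferichExcess
    rw [← hS, hSW]
    refine (Finset.prod_filter_of_ne fun p _ hne => ?_).symm
    by_contra hlt
    apply hne
    have : wieferichLevel q p - 1 = 0 := by omega
    rw [this, pow_zero]
  -- step 2: group by order
  have h2 : ∏ p ∈ SW, p ^ (wieferichLevel q p - 1) =
      ∏ d ∈ wieferichOrders q k, ∏ p ∈ SW with ordMod q p = d, p ^ (wieferichLevel q p - 1) := by
    rw [wieferichOrders, ← hS, ← hSW]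
    exact (Finset.prod_fiberwise_of_maps_to (fun p hp => Finset.mem_image_of_mem _ hp) _).symm
  -- step 3: each group is ≤ q^d
  have h3 : ∀ d ∈ wieferichOrders q k,
      ∏ p ∈ SW with ordMod q p = d, p ^ (wieferichLevel q p - 1) ≤ q ^ d := by
    intro d hd
    obtain ⟨p₀, hp₀, rfl⟩ := Finset.mem_image.mp hd
    have hp₀S := (Finset.mem_filter.mp hp₀).1
    obtain ⟨hp₀r, -, -, hp₀q⟩ := hmemS p₀ hp₀S
    set d := ordMod q p₀ with hdd
    have hdpos : 0 < d := ordMod_pos hp₀r hp₀q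
    have hn : 0 < q ^ d - 1 := by have := two_le_pow hq2 hdpos; omega
    -- the product of the full levels divides q^d - 1
    have hdvd : ∏ p ∈ SW with ordMod q p = d, p ^ wieferichLevel q p ∣ q ^ d - 1 := by
      refine prod_prime_pow_dvd_of_forall_dvd (fun r hr => ?_) _ hn.ne' (fun r hr => ?_)
      · exact (hmemS r (Finset.mem_filter.mp (Finset.mem_filter.mp hr).1).1).1
      · obtain ⟨hrSW, hrd⟩ := Finset.mem_filter.mp hr
        obtain ⟨hrr, hr2, -, hrq⟩ := hmemS r (Finset.mem_filter.mp hrSW).1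
        rw [← hrd]
        exact pow_wieferichLevel_dvd hq2 hrr hr2 hrq
    calc ∏ p ∈ SW with ordMod q p = d, p ^ (wieferichLevel q p - 1)
        ≤ ∏ p ∈ SW with ordMod q p = d, p ^ wieferichLevel q p := by
          apply Finset.prod_le_prod' fun p hp => ?_
          have hpr := (hmemS p (Finset.mem_filter.mp (Finset.mem_filter.mp hp).1).1).1
          exact Nat.pow_le_pow_right hpr.pos (Nat.sub_le _ _)
      _ ≤ q ^ d - 1 := Nat.le_of_dvd hn hdvd
      _ ≤ q ^ d := Nat.sub_le _ _
  rw [h1, h2, ← Finset.prod_pow_eq_pow_sum]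
  exact Finset.prod_le_prod' h3

/-- Real-logarithmic form of the order budget: `log E_W(q,k) ≤ (Σ_{d ∈ wieferichOrders q k} d) · log q`. [folklore] -/
theorem log_oddWieferichExcess_le {q k : ℕ} (hq : q.Prime) (hk : 1 ≤ k) :
    Real.log (oddWieferichExcess q k) ≤ (∑ d ∈ wieferichOrders q k, d : ℕ) * Real.log q := by
  have h := oddWieferichExcess_le_pow_sum_orders hq hk
  have hE0 : (0 : ℝ) < oddWieferichExcess q k := by exact_mod_cast oddWieferichExcess_pos q k
  have h' : (oddWieferichExcess q k : ℝ) ≤ (q : ℝ) ^ (∑ d ∈ wieferichOrders q k, d) := by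
    exact_mod_cast h
  calc Real.log (oddWieferichExcess q k) ≤ Real.log ((q : ℝ) ^ (∑ d ∈ wieferichOrders q k, d)) :=
        Real.log_le_log hE0 h'
    _ = (∑ d ∈ wieferichOrders q k, d : ℕ) * Real.log q := by rw [Real.log_pow]

/-- **Shape of any disproof, order form.** If the crux fails at the prime `q`, then for some `ε > 0` and
every `M`, some `k ≥ 1` has Wieferich orders (orders `ord_p(q) ∣ k` of level-`≥ 2` primes `p ∣ q^k − 1`)
summing to at least `M + εk`: the Wieferich primes to base `q` must sit at multiplicative orders filling a
positive proportion of `k`, infinitely often. (All known Wieferich data: base 2 orders `364`, `1755`.) [folklore] -/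
theorem not_PPRAt_imp_order_budget {q : ℕ} (hq : q.Prime)
    (h : ¬ ∀ ε : ℝ, 0 < ε → ∃ C : ℝ, 0 < C ∧ ∀ k : ℕ, 1 ≤ k →
      ((q ^ k : ℕ) : ℝ) < C * ((rad 1 (q ^ k - 1) (q ^ k) : ℕ) : ℝ) ^ (1 + ε)) :
    ∃ ε : ℝ, 0 < ε ∧ ∀ M : ℝ, ∃ k : ℕ, 1 ≤ k ∧
      M + ε * k ≤ ((∑ d ∈ wieferichOrders q k, d : ℕ) : ℝ) := by
  rw [PPRAt_iff_wieferichSparse hq] at h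
  simp only [not_forall, not_exists, not_and, not_lt, exists_prop] at h
  obtain ⟨ε, hε, hC⟩ := h
  have hq0 : (0 : ℝ) < q := by exact_mod_cast hq.pos
  have hq1 : (1 : ℝ) < q := by exact_mod_cast hq.one_lt
  have hlogq : 0 < Real.log q := Real.log_pos hq1
  refine ⟨ε, hε, fun M => ?_⟩
  -- use C = q^M
  obtain ⟨k, hk, hle⟩ := hC ((q : ℝ) ^ M) (Real.rpow_pos_of_pos hq0 M)
  refine ⟨k, hk, ?_⟩
  have hE0 : (0 : ℝ) < oddWieferichExcess q k := by exact_mod_cast oddWieferichExcess_pos q k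
  -- log of  q^M * q^(ε k) ≤ E_W ≤ q^(Σ d)
  have h1 : (q : ℝ) ^ M * (q : ℝ) ^ (ε * k) = (q : ℝ) ^ (M + ε * k) := by
    rw [← Real.rpow_add hq0]
  rw [h1] at hle
  have h2 := Real.log_le_log (Real.rpow_pos_of_pos hq0 _) hle
  rw [Real.log_rpow hq0] at h2
  have h3 := log_oddWieferichExcess_le hq hk
  have h4 : (M + ε * k) * Real.log q ≤ ((∑ d ∈ wieferichOrders q k, d : ℕ) : ℝ) * Real.log q :=
    le_trans h2 h3
  exact le_of_mul_le_mul_right h4 hlogq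


/-! ## The level ladder of a proof -/

/-- If all odd primes `p > P₀` dividing `q^k − 1` have Wieferich level `≥ n`, then the product `R'` of those primes
satisfies `R'^n ∣ q^k − 1`. [folklore] -/
theorem prod_pow_dvd_of_levels_ge {q k P₀ n : ℕ} (hq : 2 ≤ q) (hk : 1 ≤ k)
    (hW : ∀ p : ℕ, p.Prime → p ≠ 2 → P₀ < p → p ∣ q ^ k - 1 → n ≤ wieferichLevel q p) :
    (∏ p ∈ ((q ^ k - 1).primeFactors.erase 2).filter (fun p => P₀ < p), p) ^ n ∣ q ^ k - 1 := by
  have hn0 : q ^ k - 1 ≠ 0 := by have := two_le_pow hq hk; omega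
  rw [← Finset.prod_pow]
  refine prod_prime_pow_dvd_of_forall_dvd (fun r hr => ?_) (fun _ => n) hn0 (fun r hr => ?_)
  · exact Nat.prime_of_mem_primeFactors (Finset.mem_of_mem_erase (Finset.mem_filter.mp hr).1)
  · obtain ⟨hrS, hrP⟩ := Finset.mem_filter.mp hr
    obtain ⟨hr2, hrF⟩ := Finset.mem_erase.mp hrS
    have hrp : r.Prime := Nat.prime_of_mem_primeFactors hrF
    have hrk : r ∣ q ^ k - 1 := Nat.dvd_of_mem_primeFactors hrF
    haveI := Fact.mk hrp
    refine (padicValNat_dvd_iff_le hn0).mpr ?_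
    rw [padicValNat_family hq hrp hr2 hk hrk]
    have := hW r hrp hr2 hrP hrk
    omega

/-- … and `rad(q^k − 1)` divides `(∏_{p ≤ P₀ prime} p) · 2 · R'`. [folklore] -/
theorem radical_dvd_prod_large (q k P₀ : ℕ) :
    radical (q ^ k - 1) ∣ (∏ p ∈ (Finset.range (P₀ + 1)).filter Nat.Prime, p) * 2 *
      ∏ p ∈ ((q ^ k - 1).primeFactors.erase 2).filter (fun p => P₀ < p), p := by
  set P := ∏ p ∈ (Finset.range (P₀ + 1)).filter Nat.Prime, p with hP
  set R' := ∏ p ∈ ((q ^ k - 1).primeFactors.erase 2).filter (fun p => P₀ < p), p with hR'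
  have hP0 : P ≠ 0 := Finset.prod_ne_zero_iff.mpr fun p hp => (Finset.mem_filter.mp hp).2.ne_zero
  have hR0 : R' ≠ 0 := Finset.prod_ne_zero_iff.mpr fun p hp =>
    (Nat.prime_of_mem_primeFactors (Finset.mem_of_mem_erase (Finset.mem_filter.mp hp).1)).ne_zero
  have hM0 : P * 2 * R' ≠ 0 := mul_ne_zero (mul_ne_zero hP0 two_ne_zero) hR0
  rw [Nat.radical_dvd_iff hM0]
  intro r hr
  have hrp : r.Prime := Nat.prime_of_mem_primeFactors hr
  refine Nat.mem_primeFactors.mpr ⟨hrp, ?_, hM0⟩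
  by_cases hr2 : r = 2
  · subst hr2; exact dvd_mul_of_dvd_left (dvd_mul_left 2 P) _
  by_cases hrP : r ≤ P₀
  · have : r ∣ P := Finset.dvd_prod_of_mem _
      (Finset.mem_filter.mpr ⟨Finset.mem_range.mpr (by omega), hrp⟩)
    exact dvd_mul_of_dvd_left (dvd_mul_of_dvd_left this 2) _
  · have hmem : r ∈ ((q ^ k - 1).primeFactors.erase 2).filter (fun p => P₀ < p) :=
      Finset.mem_filter.mpr ⟨Finset.mem_erase.mpr ⟨hr2, hr⟩, by omega⟩
    exact dvd_mul_of_dvd_right (Finset.dvd_prod_of_mem _ hmem) _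

/-- **THE LEVEL LADDER.** The crux at a prime `q` and ONE exponent defect `ε` already forces infinitely many
primes `p` of Wieferich level `W_p(q) ≤ E` for every integer `E > ε` (for `ε < 1`, `E = 1`: infinitely many
non-Wieferich primes — Silverman's direction `Negative/NonWieferich.lean`; for larger `ε` the bounded-level
non-Wieferich infinitude of BarrierNotes-r1-k2 B1, open for every level). Proof: if all odd `p > P₀` had level
`≥ E + 1`, then `rad(q^k − 1) ≤ 2P·R'` with `R'^{E+1} ≤ q^k`, so `q^k < C (q·rad)^{1+ε} ≤ K q^{k(1+ε)/(E+1)}`,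
absurd for large `k`. [folklore] -/
theorem infinite_level_le_of_PPRAt {q : ℕ} (hq : q.Prime) {ε : ℝ} (hε : 0 < ε) (E : ℕ) (hE : ε < E)
    (h : ∃ C : ℝ, 0 < C ∧ ∀ k : ℕ, 1 ≤ k →
      ((q ^ k : ℕ) : ℝ) < C * ((rad 1 (q ^ k - 1) (q ^ k) : ℕ) : ℝ) ^ (1 + ε)) :
    {p : ℕ | p.Prime ∧ wieferichLevel q p ≤ E}.Infinite := by
  intro hfin
  obtain ⟨P₀, hP₀⟩ := hfin.bddAbove
  have hq2 := hq.two_le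
  have hq0 : (0 : ℝ) < q := by exact_mod_cast hq.pos
  have hq1 : (1 : ℝ) < q := by exact_mod_cast hq.one_lt
  have hlogq : 0 < Real.log q := Real.log_pos hq1
  obtain ⟨C, hC, hCk⟩ := h
  set t : ℝ := 1 + ε with ht
  have ht0 : 0 < t := by linarith
  set n : ℕ := E + 1 with hn
  have hn0 : (0 : ℝ) < n := by rw [hn]; positivity
  have htn : t < n := by rw [ht, hn]; push_cast; linarith
  -- levels of the large odd primes
  have hW : ∀ k : ℕ, ∀ p : ℕ, p.Prime → p ≠ 2 → P₀ < p → p ∣ q ^ k - 1 → n ≤ wieferichLevel q p := by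
    intro k p hp hp2 hpP _
    by_contra hlt
    have : p ≤ P₀ := hP₀ ⟨hp, by rw [hn] at hlt; omega⟩
    omega
  set P : ℕ := ∏ p ∈ (Finset.range (P₀ + 1)).filter Nat.Prime, p with hP
  have hPpos : (0 : ℝ) < P := by
    have : P ≠ 0 := Finset.prod_ne_zero_iff.mpr fun p hp => (Finset.mem_filter.mp hp).2.ne_zero
    exact_mod_cast Nat.pos_of_ne_zero this
  -- the constant K and the exponent gap
  set K : ℝ := C * (2 * P * q) ^ t with hK
  have hK0 : 0 < K := by positivity
  set γ : ℝ := 1 - t / n with hγ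
  have hγ0 : 0 < γ := by
    rw [hγ, sub_pos, div_lt_one hn0]; exact htn
  have key : ∀ k : ℕ, 1 ≤ k → (q : ℝ) ^ (γ * k) < K := by
    intro k hk
    set R' : ℕ := ∏ p ∈ ((q ^ k - 1).primeFactors.erase 2).filter (fun p => P₀ < p), p with hR'
    have hR'0 : (0 : ℝ) < R' := by
      have : R' ≠ 0 := Finset.prod_ne_zero_iff.mpr fun p hp =>
        (Nat.prime_of_mem_primeFactors (Finset.mem_of_mem_erase (Finset.mem_filter.mp hp).1)).ne_zero
      exact_mod_cast Nat.pos_of_ne_zero this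
    -- (i) R'^n ≤ q^k
    have h3 : (R' : ℝ) ^ (n : ℝ) ≤ (q : ℝ) ^ (k : ℝ) := by
      have hd := prod_pow_dvd_of_levels_ge hq2 hk (hW k)
      have hpos : 0 < q ^ k - 1 := by have := two_le_pow hq2 hk; omega
      have hle : R' ^ n ≤ q ^ k := le_trans (Nat.le_of_dvd hpos hd) (Nat.sub_le _ _)
      have : ((R' ^ n : ℕ) : ℝ) ≤ ((q ^ k : ℕ) : ℝ) := by exact_mod_cast hle
      push_cast at this
      rwa [Real.rpow_natCast, Real.rpow_natCast]
    -- (ii) rad(q^k - 1) ≤ 2 P R'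
    set R : ℝ := ((radical (q ^ k - 1) : ℕ) : ℝ) with hRdef
    have hR0 : 0 < R := by rw [hRdef]; exact_mod_cast Nat.radical_pos _
    have h2 : R ≤ 2 * P * R' := by
      have hd := radical_dvd_prod_large q k P₀
      have hM0 : 0 < P * 2 * R' := by
        have : (0:ℝ) < P * 2 * R' := by positivity
        exact_mod_cast this
      have hle := Nat.le_of_dvd hM0 hd
      have : ((radical (q ^ k - 1) : ℕ) : ℝ) ≤ ((P * 2 * R' : ℕ) : ℝ) := by exact_mod_cast hle
      rw [hRdef]; push_cast at this ⊢; linarith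
    -- (iii) the crux instance
    have h1 : (q : ℝ) ^ (k : ℝ) < C * (R * q) ^ t := by
      have := hCk k hk
      rw [rad_family_eq hq hk] at this
      push_cast at this
      rwa [← Real.rpow_natCast] at this
    -- combine: (R q)^t ≤ (2 P q)^t R'^t and R'^t ≤ q^(k t / n)
    have h4 : (R * q) ^ t ≤ (2 * P * q) ^ t * (R' : ℝ) ^ t := by
      rw [← Real.mul_rpow (by positivity) hR'0.le]
      exact Real.rpow_le_rpow (by positivity) (by nlinarith) ht0.le
    have h5 : (R' : ℝ) ^ t ≤ (q : ℝ) ^ ((k : ℝ) * (t / n)) := by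
      have e1 : (R' : ℝ) ^ t = ((R' : ℝ) ^ (n : ℝ)) ^ (t / n) := by
        rw [← Real.rpow_mul hR'0.le]; congr 1; field_simp
      rw [e1, Real.rpow_mul hq0.le]
      exact Real.rpow_le_rpow (by positivity) h3 (by positivity)
    have h6 : (q : ℝ) ^ (k : ℝ) < K * (q : ℝ) ^ ((k : ℝ) * (t / n)) := by
      calc (q : ℝ) ^ (k : ℝ) < C * (R * q) ^ t := h1
        _ ≤ C * ((2 * P * q) ^ t * (R' : ℝ) ^ t) := mul_le_mul_of_nonneg_left h4 hC.le
        _ ≤ C * ((2 * P * q) ^ t * (q : ℝ) ^ ((k : ℝ) * (t / n))) := by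
            apply mul_le_mul_of_nonneg_left _ hC.le
            exact mul_le_mul_of_nonneg_left h5 (Real.rpow_nonneg (by positivity) _)
        _ = K * (q : ℝ) ^ ((k : ℝ) * (t / n)) := by rw [hK]; ring
    have hQ : (0 : ℝ) < (q : ℝ) ^ ((k : ℝ) * (t / n)) := Real.rpow_pos_of_pos hq0 _
    have e2 : (q : ℝ) ^ (γ * k) = (q : ℝ) ^ (k : ℝ) / (q : ℝ) ^ ((k : ℝ) * (t / n)) := by
      rw [eq_div_iff hQ.ne', ← Real.rpow_add hq0]; congr 1; rw [hγ]; ring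
    rw [e2, div_lt_iff₀ hQ]
    exact h6
  -- Archimedes: q^(γ k) ≥ 1 + γ k log q is unbounded
  obtain ⟨k, hk⟩ := exists_nat_gt (K / (γ * Real.log q))
  have hk1 : 1 ≤ k + 1 := by omega
  have h := key (k + 1) hk1
  have hexp : 1 + γ * (k + 1 : ℕ) * Real.log q ≤ (q : ℝ) ^ (γ * (k + 1 : ℕ)) := by
    rw [Real.rpow_def_of_pos hq0]
    have := Real.add_one_le_exp (Real.log q * (γ * (k + 1 : ℕ)))
    linarith
  rw [div_lt_iff₀ (mul_pos hγ0 hlogq)] at hk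
  push_cast at hexp h hk
  nlinarith

/-- Level `≤ 1` at an odd prime not dividing the base means: not a Wieferich prime. [folklore] -/
theorem not_isWieferich_of_wieferichLevel_le_one {q p : ℕ} (hq : 2 ≤ q) (hp : p.Prime) (hp2 : p ≠ 2)
    (hpq : ¬ p ∣ q) (h : wieferichLevel q p ≤ 1) : ¬ IsWieferich q p := by
  rw [isWieferich_iff_two_le_wieferichLevel hq hp hp2 hpq]; omega

/-- **`PrimePowerRadical` ⟹ for every prime `q` and every level `E ≥ 1`, infinitely many primes of Wieferich
level `≤ E` to base `q`** (the whole ladder of open bounded-level statements; rung `E = 1` is Silverman's). [folklore] -/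
theorem primePowerRadical_imp_infinite_level_le (h : PrimePowerRadical) (q : ℕ) (hq : q.Prime)
    (E : ℕ) (hE : 1 ≤ E) : {p : ℕ | p.Prime ∧ wieferichLevel q p ≤ E}.Infinite := by
  have h12 : (1 / 2 : ℝ) < E := by
    have : (1 : ℝ) ≤ E := by exact_mod_cast hE
    linarith
  exact infinite_level_le_of_PPRAt hq (by norm_num) E h12 (h q hq (1 / 2) (by norm_num))

end Summit.ABC.ABC.Theorems.PrimePowerRadical.Negative

end
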